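import Literature.AlgebraicGeometry.Resolution.ProperModelsPatching
import Literature.AlgebraicGeometry.Resolution.ProperModelsModification
import Literature.AlgebraicGeometry.Resolution.ProperModelsJoin
import Literature.AlgebraicGeometry.Resolution.ZariskiPatchingProperModels
import Literature.AlgebraicGeometry.Resolution.CanonicalResolutionProofs
import Literature.AlgebraicGeometry.Resolution.BlowupsFlatBaseChange
import Literature.AlgebraicGeometry.Resolution.PrincipalizationToResolution
import Literature.AlgebraicGeometry.Resolution.RegularLocalRingsProofs
import Literature.AlgebraicGeometry.Morphisms.OpenGluing
import Literature.AlgebraicGeometry.Morphisms.NagataCompactification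
import Summits.ResolutionOfSingularities.ResolutionOfSingularities.Theses.Valuative

/-!
# Line certificate for crux `Valuative.PatchingRel` (stmt-ResolutionOfSingularities-0642),
# line `sandwiched-gluing` — drefute gen 2 (refuter-drefute-stmt-ResolutionOfSingularities-0642-g2-0)

All four DISCHARGEABLE stubs of the lead's reshaped 7-stub skeleton (registered 2026-08-16T00:32Z)
are proved here, signatures verbatim:

* S1 `stub_resolutionInChar_of_properPatching` — by the landed `resolutionInChar_of_properTwoModelPatching_of_relLU`;
* S2 `stub_regLeification_of_local` — Extension → LocalRegLeification p → RegLeification p;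
* S3 `stub_localRegLeification_of_sandwiched` — OpenGluing → SAND⁺ p → LocalRegLeification p;
* S5 `stub_properExtension_of_nagata` — NagataCompactification → Extension;

together with the inline glue `twoModelPatching_of_regLeification` (RegLe-ification twice on
`ProperModel.join`). Consequently the crux is reduced, kernel-checked, to the two NAMED FACTS
(S4 `OpenGluing` = Stacks 01LH two-piece case; S6 `NagataCompactification` = Conrad 2007 Thm 4.1 /
Stacks 0F41) and the line's residual OPEN atom (S7 `SandwichedStrongResolution p`, all primes `p`;
= Cossart–Piltant 2019 Thm 1.1 (i)–(ii) in dimension ≤ 3, open in dimension ≥ 4):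

  `patchingRel_of_nagata_openGluing_sand :
     NagataCompactification.{0} → OpenGluing.{0} → (∀ p, p.Prime → SandwichedStrongResolution.{0} p) →
       Valuative.PatchingRel`.

This file is refuter EVIDENCE (a refuter may land only `¬`-theorems); the lead / a prover may land
it verbatim (suggested home: `Literature/AlgebraicGeometry/Resolution/ProperModelsPatchingGluing.lean`
for S2/S3/S5 + glue, and `Summits/…/Theorems/ValuativePatchingRelOfSandwiched.lean` for the
certificate). lean check: rc 0, 0 sorry, axioms {propext, Classical.choice, Quot.sound}.
-/

open CategoryTheory AlgebraicGeometry TopologicalSpace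
open Literature.AlgebraicGeometry.Resolution Literature.AlgebraicGeometry.Morphisms

namespace Literature.AlgebraicGeometry.Resolution.SandwichedGluing

/-! ### S2: Extension → LocalRegLeification → RegLeification -/

/-- In a cartesian square of schemes the range of the first projection is the preimage of the
range of the opposite side. -/
theorem range_fst_of_isPullback' {X Y Z W : Scheme.{0}} {fst : X ⟶ Y} {snd : X ⟶ Z} {f : Y ⟶ W}
    {g : Z ⟶ W} (H : IsPullback fst snd f g) :
    Set.range fst.base = f.base ⁻¹' Set.range g.base := by
  rw [← H.isoPullback_hom_fst, Scheme.Hom.comp_base, TopCat.coe_comp, Set.range_comp,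
    show Set.range ⇑H.isoPullback.hom = Set.univ from
      Set.range_eq_univ.mpr H.isoPullback.hom.homeomorph.surjective, Set.image_univ]
  exact Scheme.Pullback.range_fst f g

/-- Regularity of stalks transports along an open immersion. -/
theorem isRegularLocalRing_stalk_of_isOpenImmersion {N X : Scheme.{0}} (i : N ⟶ X)
    [IsOpenImmersion i] (n : N) (h : IsRegularLocalRing (N.presheaf.stalk n)) :
    IsRegularLocalRing (X.presheaf.stalk (i.base n)) :=
  IsRegularLocalRing.of_ringEquiv (asIso (i.stalkMap n)).commRingCatIsoToRingEquiv.symm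

/-- S2, verbatim signature. -/
theorem stub_regLeification_of_local :
    ∀ p : ℕ, (∀ (k : Type) [Field k] (K : Type) [Field K] [Algebra k K] (P : ProperModel k K) (U : P.X.Opens) (Y : Scheme.{0}) [IsIntegral Y] (g : Y ⟶ (U : Scheme.{0})) [IsProper g], IsBirational g → ∃ (P' : ProperModel k K) (φ : P'.Hom P) (i : Y ⟶ P'.X), IsOpenImmersion i ∧ IsPullback i g φ.f U.ι) → ProperModel.LocalRegLeification.{0} p → ProperModel.RegLeification.{0} p := by
  intro p hExt hLoc k _ _ K _ _ _ M Y φ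
  obtain ⟨O, N, ρ, hint, hprop, hbir, h4, h5, h6, h7⟩ := hLoc k K M Y φ
  haveI := hint
  haveI := hprop
  obtain ⟨P', φ', i, hi, hpb⟩ := hExt k K M O N ρ hbir
  haveI := hi
  -- range i = φ'⁻¹(O)
  have hrange : ∀ y : P'.X, φ'.f.base y ∈ (O : Set M.X) → ∃ n : N, i.base n = y := by
    intro y hy
    have h1 : y ∈ φ'.f.base ⁻¹' Set.range O.ι.base := by
      rw [Scheme.Opens.range_ι]; exact hy
    rw [← range_fst_of_isPullback' hpb] at h1
    exact h1
  -- the square on points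
  have hw : ∀ n : N, φ'.f.base (i.base n) = (ρ.base n).1 := by
    intro n
    have := congrArg (fun f : N ⟶ M.X => f.base n) hpb.w
    simpa [Scheme.Hom.comp_base] using this
  refine ⟨P', φ', ?_, ?_⟩
  · intro y hy
    obtain ⟨n, rfl⟩ := hrange y (h4 _ hy)
    apply isRegularLocalRing_stalk_of_isOpenImmersion i n
    apply h6
    rw [← hw]; exact hy
  · intro y hy
    rw [ProperModel.Hom.comp_f, Scheme.Hom.comp_apply] at hy
    obtain ⟨n, rfl⟩ := hrange y (h5 _ hy)
    apply isRegularLocalRing_stalk_of_isOpenImmersion i n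
    apply h7
    rw [← hw]; exact hy


/-! ### S5: Nagata ⇒ Extension of proper models -/

/-- CLOPEN LEMMA: an open immersion into an irreducible scheme which becomes proper after a
separated map is an isomorphism (nonempty source). -/
theorem isIso_of_isOpenImmersion_of_isProper_comp {Z T B : Scheme.{0}} (i : Z ⟶ T)
    [IsOpenImmersion i] (h : T ⟶ B) [IsSeparated h] [IsProper (i ≫ h)] [IrreducibleSpace T]
    [Nonempty Z] : IsIso i := by
  haveI : IsProper i := IsProper.of_comp i h
  apply isIso_of_isOpenImmersion_of_opensRange_eq_top
  have hclopen : IsClopen (Set.range i.base) :=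
    ⟨i.isClosedMap.isClosed_range, i.isOpenEmbedding.isOpen_range⟩
  have huniv : Set.range i.base = Set.univ :=
    hclopen.eq_univ (Set.range_nonempty _)
  ext x
  simp only [Scheme.Hom.coe_opensRange, Opens.coe_top, huniv]

/-- S5, verbatim signature. -/
theorem stub_properExtension_of_nagata :
    NagataCompactification.{0} → ∀ (k : Type) [Field k] (K : Type) [Field K] [Algebra k K] (P : ProperModel k K) (U : P.X.Opens) (Y : Scheme.{0}) [IsIntegral Y] (g : Y ⟶ (U : Scheme.{0})) [IsProper g], IsBirational g → ∃ (P' : ProperModel k K) (φ : P'.Hom P) (i : Y ⟶ P'.X), IsOpenImmersion i ∧ IsPullback i g φ.f U.ι := by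
  intro hN k _ K _ _ P U Y _ g _ hbir
  -- Noetherian bookkeeping
  haveI : Nonempty Y := inferInstance
  haveI : Nonempty (U : Scheme.{0}) := ⟨g.base (Classical.arbitrary Y)⟩
  haveI : IsIntegral (U : Scheme.{0}) := isIntegral_of_isOpenImmersion U.ι
  haveI : IsLocallyNoetherian Y := LocallyOfFiniteType.isLocallyNoetherian g
  haveI : CompactSpace (U : Scheme.{0}) := by
    haveI : NoetherianSpace (U : Scheme.{0}) := NoetherianSpace.set _
    infer_instance
  haveI : CompactSpace Y := QuasiCompact.compactSpace_of_compactSpace g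
  haveI : IsNoetherian Y := {}
  let f : Y ⟶ P.X := g ≫ U.ι
  haveI : IsSeparated f := inferInstance
  haveI : LocallyOfFiniteType f := inferInstance
  haveI : QuasiCompact f := inferInstance
  -- Nagata
  obtain ⟨Xc, j, gc, hj, hgc, hfac⟩ := hN Y P.X f
  haveI := hj
  haveI := hgc
  -- the closure of `Y` in the compactification
  haveI : IsIntegral j.image := ChowLemmaProof.isIntegral_image j
  let i : Y ⟶ j.image := j.toImage
  haveI hiopen : IsOpenImmersion i := by simp only [i]; infer_instance
  let ρ : j.image ⟶ P.X := j.imageι ≫ gc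
  haveI : IsProper ρ := inferInstance
  have hiρ : i ≫ ρ = g ≫ U.ι := by
    simp only [i, ρ, Scheme.Hom.toImage_imageι_assoc, hfac, f]
  -- `Y ≅ ρ⁻¹(U)`
  have hrange : Set.range i.base ⊆ Set.range (ρ ⁻¹ᵁ U).ι.base := by
    rw [Scheme.Opens.range_ι]
    rintro _ ⟨y, rfl⟩
    show ρ.base (i.base y) ∈ U
    rw [← Scheme.Hom.comp_apply, hiρ, Scheme.Hom.comp_apply]
    exact (g.base y).2
  let i' : Y ⟶ (ρ ⁻¹ᵁ U : Scheme.{0}) := IsOpenImmersion.lift (ρ ⁻¹ᵁ U).ι i hrange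
  have hi' : i' ≫ (ρ ⁻¹ᵁ U).ι = i := IsOpenImmersion.lift_fac _ _ _
  haveI : IsOpenImmersion i' := by
    have : IsOpenImmersion (i' ≫ (ρ ⁻¹ᵁ U).ι) := by rw [hi']; infer_instance
    exact IsOpenImmersion.of_comp i' (ρ ⁻¹ᵁ U).ι
  have hi'g : i' ≫ (ρ ∣_ U) = g := by
    rw [← cancel_mono U.ι, Category.assoc, morphismRestrict_ι, ← Category.assoc, hi', hiρ]
  haveI : IsProper (i' ≫ (ρ ∣_ U)) := by rw [hi'g]; infer_instance
  haveI : Nonempty (ρ ⁻¹ᵁ U : Scheme.{0}) := ⟨i'.base (Classical.arbitrary Y)⟩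
  haveI : IsIntegral (ρ ⁻¹ᵁ U : Scheme.{0}) := isIntegral_of_isOpenImmersion (ρ ⁻¹ᵁ U).ι
  haveI : IsIso i' := isIso_of_isOpenImmersion_of_isProper_comp i' (ρ ∣_ U)
  have hpb : IsPullback i g ρ U.ι := by
    have A : IsPullback i' g (ρ ∣_ U) (𝟙 _) :=
      IsPullback.of_horiz_isIso ⟨by rw [hi'g, Category.comp_id]⟩
    have B := A.paste_horiz (isPullback_morphismRestrict ρ U).flip
    rwa [hi', Category.id_comp] at B
  -- `ρ` is an isomorphism over the image of the iso-locus of `g`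
  obtain ⟨U₀, hU₀d, -, hU₀iso⟩ := hbir
  haveI := hU₀iso
  let U₁ : P.X.Opens := U.ι ''ᵁ U₀
  have hU₀ne : (U₀ : Set (U : Scheme.{0})).Nonempty := hU₀d.nonempty
  have hU₁ne : (U₁ : Set P.X).Nonempty := by
    obtain ⟨x, hx⟩ := hU₀ne
    exact ⟨U.ι.base x, ⟨x, hx, rfl⟩⟩
  let s : (U₁ : Scheme.{0}) ⟶ j.image :=
    (U.ι.isoImage U₀).inv ≫ inv (g ∣_ U₀) ≫ (g ⁻¹ᵁ U₀).ι ≫ i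
  have hs : s ≫ ρ = U₁.ι := by
    simp only [s, Category.assoc, hiρ]
    rw [← morphismRestrict_ι_assoc, IsIso.inv_hom_id_assoc, Scheme.Hom.isoImage_inv_ι]
  haveI : IsOpenImmersion s := by
    simp only [s]; infer_instance
  haveI : Nonempty (g ⁻¹ᵁ U₀ : Scheme.{0}) := by
    haveI : Nonempty (U₀ : Scheme.{0}) := by
      obtain ⟨x, hx⟩ := hU₀ne; exact ⟨⟨x, hx⟩⟩
    exact ⟨(inv (g ∣_ U₀)).base (Classical.arbitrary _)⟩
  haveI : Nonempty (U₁ : Scheme.{0}) := by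
    obtain ⟨x, hx⟩ := hU₁ne; exact ⟨⟨x, hx⟩⟩
  haveI : IsDominant s := ⟨s.isOpenEmbedding.isOpen_range.dense (Set.range_nonempty _)⟩
  haveI : IsIso (ρ ∣_ U₁) := (ChowLemmaProof.isIso_morphismRestrict_of_section ρ U₁ s hs).1
  -- the proper model
  exact ⟨ProperModel.ofModification P ρ U₁ hU₁ne, ProperModel.ofModificationHom P ρ U₁ hU₁ne, i,
    hiopen, hpb⟩


/-! ### S3: OpenGluing → SAND⁺ → LocalRegLeification -/

/-! ### Topology / small helpers -/

/-- A space covered by two preirreducible opens with non-empty intersection is preirreducible. -/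
theorem preirreducibleSpace_of_union {α : Type*} [TopologicalSpace α] {A B : Set α}
    (hA : IsOpen A) (hB : IsOpen B) (hAi : IsPreirreducible A) (hBi : IsPreirreducible B)
    (hcov : A ∪ B = Set.univ) (hAB : (A ∩ B).Nonempty) : PreirreducibleSpace α := by
  constructor
  intro u v hu hv hxu hyv
  -- every non-empty open meets `A ∩ B`
  have key : ∀ u : Set α, IsOpen u → (Set.univ ∩ u).Nonempty → (A ∩ (B ∩ u)).Nonempty := by
    rintro u hu ⟨x, -, hx⟩
    have hx' : x ∈ A ∪ B := by rw [hcov]; trivial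
    rcases hx' with hxA | hxB
    · obtain ⟨z, hzA, hzu, hzB⟩ := hAi u B hu hB ⟨x, hxA, hx⟩ hAB
      exact ⟨z, hzA, hzB, hzu⟩
    · obtain ⟨z, hzB, hzu, hzA⟩ := hBi u A hu hA ⟨x, hxB, hx⟩ (by rwa [Set.inter_comm])
      exact ⟨z, hzA, hzB, hzu⟩
  obtain ⟨z, -, hz⟩ := hAi (B ∩ u) (B ∩ v) (hB.inter hu) (hB.inter hv) (key u hu hxu) (key v hv hyv)
  exact ⟨z, trivial, hz.1.2, hz.2.2⟩

/-- The range of a morphism from a preirreducible scheme is preirreducible. -/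
theorem isPreirreducible_range {X Y : Scheme.{0}} (f : X ⟶ Y) [PreirreducibleSpace X] :
    IsPreirreducible (Set.range f.base) := by
  rw [← Set.image_univ]
  exact (PreirreducibleSpace.isPreirreducible_univ (X := X)).image f.base
    f.base.hom.continuous.continuousOn

/-- Preirreducibility transports along isomorphisms of schemes. -/
theorem preirreducibleSpace_of_iso {X Y : Scheme.{0}} (e : X ≅ Y) [PreirreducibleSpace Y] :
    PreirreducibleSpace X := by
  constructor
  have h := isPreirreducible_range e.inv
  rwa [Set.range_eq_univ.mpr e.inv.surjective] at h

/-- An open subscheme of a preirreducible scheme is preirreducible. -/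
theorem preirreducibleSpace_opens {X : Scheme.{0}} [PreirreducibleSpace X] (U : X.Opens) :
    PreirreducibleSpace (U : Scheme.{0}) := by
  constructor
  have h1 : IsPreirreducible (U : Set X) :=
    (PreirreducibleSpace.isPreirreducible_univ (X := X)).open_subset U.2 (Set.subset_univ _)
  have h2 := h1.preimage U.ι.isOpenEmbedding
  have h3 : U.ι.base ⁻¹' (U : Set X) = Set.univ := Set.eq_univ_of_forall fun x => x.2
  rwa [h3] at h2

/-- A regular scheme is reduced. -/
theorem isReduced_of_isRegular {X : Scheme.{0}} (h : Scheme.IsRegular X) : IsReduced X := by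
  haveI : ∀ x : X, _root_.IsReduced (X.presheaf.stalk x) := fun x => by
    haveI := h x
    haveI := isDomain_of_isRegularLocalRing (X.presheaf.stalk x)
    infer_instance
  exact isReduced_of_isReduced_stalk X

/-- The generic point of an integral scheme is a regular point. -/
theorem genericPoint_mem_regularLocus (X : Scheme.{0}) [IsIntegral X] :
    genericPoint X ∈ Scheme.regularLocus X := by
  rw [Scheme.mem_regularLocus]
  exact inferInstanceAs (IsRegularLocalRing X.functionField)

/-- The source of a birational morphism to a preirreducible scheme is preirreducible. -/
theorem preirreducibleSpace_of_isBirational {Z V : Scheme.{0}} (π : Z ⟶ V) (h : IsBirational π)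
    [PreirreducibleSpace V] : PreirreducibleSpace Z := by
  obtain ⟨U₀, -, hZU₀, hiso⟩ := h
  haveI := hiso
  haveI : PreirreducibleSpace (U₀ : Scheme.{0}) := preirreducibleSpace_opens U₀
  haveI : PreirreducibleSpace (π ⁻¹ᵁ U₀ : Scheme.{0}) := preirreducibleSpace_of_iso (asIso (π ∣_ U₀))
  have h1 : IsPreirreducible ((π ⁻¹ᵁ U₀ : Z.Opens) : Set Z) := by
    rw [← Scheme.Opens.range_ι]
    exact isPreirreducible_range _
  have h2 := h1.closure
  rw [hZU₀.closure_eq] at h2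
  exact ⟨h2⟩

/-- Stalks of an open subscheme: `x ∈ Reg U ↔ x.1 ∈ Reg X`. -/
theorem mem_regularLocus_opens_iff {X : Scheme.{0}} (U : X.Opens) (x : (U : Scheme.{0})) :
    IsRegularLocalRing ((U : Scheme.{0}).presheaf.stalk x) ↔
      IsRegularLocalRing (X.presheaf.stalk x.1) := by
  have := mem_regularLocus_iff_of_flat_of_isPreimmersion U.ι x
  simpa only [Scheme.mem_regularLocus, Scheme.Opens.ι_apply] using this

/-! ### The stub -/

/-- S3, verbatim signature. -/
theorem stub_localRegLeification_of_sandwiched :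
    ∀ p : ℕ, OpenGluing.{0} → SandwichedStrongResolution.{0} p → ProperModel.LocalRegLeification.{0} p := by
  intro p hOG hS k _ _ K _ _ _ M Y φ
  /- Step A: the opens `UY = Reg Y`, `V = φ⁻¹ UY` -/
  have hRegY : IsOpen (Scheme.regularLocus Y.X) := isOpen_regularLocus_of_locallyOfFiniteType_field Y.π
  have hRegM : IsOpen (Scheme.regularLocus M.X) := isOpen_regularLocus_of_locallyOfFiniteType_field M.π
  let UY : Y.X.Opens := ⟨_, hRegY⟩
  let V : M.X.Opens := φ.f ⁻¹ᵁ UY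
  have hUYne : (UY : Set Y.X).Nonempty := ⟨_, genericPoint_mem_regularLocus Y.X⟩
  haveI : Nonempty (UY : Scheme.{0}) := by obtain ⟨y, hy⟩ := hUYne; exact ⟨⟨y, hy⟩⟩
  haveI : IsIntegral (UY : Scheme.{0}) := isIntegral_of_isOpenImmersion UY.ι
  have hUYreg : Scheme.IsRegular (UY : Scheme.{0}) := fun x =>
    (mem_regularLocus_opens_iff UY x).mpr x.2
  -- `V` is non-empty: `φ.f` is surjective (proper and dominant)
  haveI : IsDominant φ.f := ProperModel.isDominant_of_comp_eq_gen φ.f M.gen φ.gen_f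
  haveI : Surjective φ.f :=
    surjective_of_isDominant_of_isClosed_range φ.f φ.f.isClosedMap.isClosed_range
  have hVne : (V : Set M.X).Nonempty := by
    obtain ⟨y, hy⟩ := hUYne
    obtain ⟨m, hm⟩ := φ.f.surjective y
    exact ⟨m, show φ.f.base m ∈ (UY : Set Y.X) by rw [hm]; exact hy⟩
  haveI : Nonempty (V : Scheme.{0}) := by obtain ⟨m, hm⟩ := hVne; exact ⟨⟨m, hm⟩⟩
  haveI : IsIntegral (V : Scheme.{0}) := isIntegral_of_isOpenImmersion V.ι
  let η : (V : Scheme.{0}) ⟶ (UY : Scheme.{0}) := φ.f ∣_ UY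
  have hηbir : IsBirational η := φ.isBirational.morphismRestrict UY
  let f : (UY : Scheme.{0}) ⟶ Spec (.of k) := UY.ι ≫ Y.π
  haveI : NoetherianSpace (UY : Scheme.{0}) := NoetherianSpace.set _
  haveI : IsSeparated f := inferInstance
  haveI : LocallyOfFiniteType f := inferInstance
  haveI : QuasiCompact f := inferInstance
  /- Step B: SAND⁺ -/
  obtain ⟨Z, π, hres, W, hW, hπW⟩ := hS k (UY : Scheme.{0}) (V : Scheme.{0}) f η inferInstance
    inferInstance inferInstance inferInstance hUYreg inferInstance inferInstance hηbir
  haveI := hres.isProper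
  haveI := hπW
  -- `W = Reg V` is non-empty, so `Z` is non-empty; `Z` is integral
  have hWne : (W : Set (V : Scheme.{0})).Nonempty := by
    refine ⟨genericPoint (V : Scheme.{0}), ?_⟩
    rw [hW]; exact genericPoint_mem_regularLocus _
  haveI : Nonempty (W : Scheme.{0}) := by obtain ⟨x, hx⟩ := hWne; exact ⟨⟨x, hx⟩⟩
  haveI : Nonempty (π ⁻¹ᵁ W : Scheme.{0}) := ⟨(inv (π ∣_ W)).base (Classical.arbitrary _)⟩
  haveI : Nonempty Z := ⟨(π ⁻¹ᵁ W).ι.base (Classical.arbitrary _)⟩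
  haveI : PreirreducibleSpace Z := preirreducibleSpace_of_isBirational π hres.isBirational
  haveI : IrreducibleSpace Z := ⟨inferInstance⟩
  haveI : IsReduced Z := isReduced_of_isRegular hres.isRegular
  haveI : IsIntegral Z := isIntegral_of_irreducibleSpace_of_isReduced Z
  /- Step C: the closed set `C = cl_M (Sing V)` and the open `O = V ∪ (M ∖ C)` -/
  let C : Set M.X := closure (V.ι.base '' (W : Set (V : Scheme.{0}))ᶜ)
  have hC : IsClosed C := isClosed_closure
  -- (C1) `V ∩ C = Sing V`
  have hC1 : ∀ v : (V : Scheme.{0}), v.1 ∈ C ↔ v ∉ W := by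
    intro v
    have hcl : closure ((W : Set (V : Scheme.{0}))ᶜ) = V.ι.base ⁻¹' C :=
      V.ι.isOpenEmbedding.isInducing.closure_eq_preimage_closure_image _
    rw [(W.isOpen.isClosed_compl).closure_eq] at hcl
    have : v ∈ (W : Set (V : Scheme.{0}))ᶜ ↔ v ∈ V.ι.base ⁻¹' C := by rw [hcl]
    rw [Set.mem_compl_iff, Set.mem_preimage] at this
    exact ⟨fun h => this.mpr h, fun h => this.mp h⟩
  -- (C2) `C ∩ Reg M = ∅`
  have hC2 : ∀ m : M.X, IsRegularLocalRing (M.X.presheaf.stalk m) → m ∉ C := by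
    intro m hm hmC
    obtain ⟨_, ⟨hreg, ⟨v, hv, rfl⟩⟩⟩ := mem_closure_iff.mp hmC _ hRegM hm
    apply hv
    show v ∈ (W : Set (V : Scheme.{0}))
    rw [hW, Scheme.mem_regularLocus, mem_regularLocus_opens_iff V v]
    exact hreg
  let C' : M.X.Opens := ⟨Cᶜ, hC.isOpen_compl⟩
  let O : M.X.Opens := V ⊔ C'
  /- Step D: gluing over `O` -/
  let V' : (O : Scheme.{0}).Opens := O.ι ⁻¹ᵁ V
  let W' : (O : Scheme.{0}).Opens := O.ι ⁻¹ᵁ C'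
  have hcover : V' ⊔ W' = ⊤ := by
    apply le_antisymm le_top
    rintro x -
    rcases x.2 with h | h
    · exact Or.inl h
    · exact Or.inr h
  have hrangeV : Set.range (V'.ι ≫ O.ι).base = Set.range V.ι.base := by
    rw [Scheme.Hom.comp_base, TopCat.coe_comp, Set.range_comp, Scheme.Opens.range_ι,
      Scheme.Opens.range_ι]
    ext m
    constructor
    · rintro ⟨x, hx, rfl⟩; exact hx
    · intro hm; exact ⟨⟨m, Or.inl hm⟩, hm, rfl⟩
  let eV : (V' : Scheme.{0}) ≅ (V : Scheme.{0}) := IsOpenImmersion.isoOfRangeEq (V'.ι ≫ O.ι) V.ι hrangeV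
  have heV : eV.hom ≫ V.ι = V'.ι ≫ O.ι := IsOpenImmersion.isoOfRangeEq_hom_fac _ _ _
  have heV' : eV.inv ≫ V'.ι ≫ O.ι = V.ι := by rw [← heV, Iso.inv_hom_id_assoc]
  have heVpt : ∀ v : (V : Scheme.{0}), (O.ι.base (V'.ι.base (eV.inv.base v))) = v.1 := by
    intro v
    have := congrArg (fun g => g.base v) heV'
    simpa [Scheme.Hom.comp_base] using this
  let π' : Z ⟶ (V' : Scheme.{0}) := π ≫ eV.inv
  haveI : IsProper π' := inferInstance
  -- the overlap `V' ∩ W'` pulled back to `V` is `W`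
  have hoverlap : eV.inv ⁻¹ᵁ (V'.ι ⁻¹ᵁ W') = W := by
    ext v
    show O.ι.base (V'.ι.base (eV.inv.base v)) ∈ (C' : Set M.X) ↔ v ∈ (W : Set (V : Scheme.{0}))
    rw [heVpt]
    show v.1 ∉ C ↔ _
    rw [hC1, not_not]; rfl
  have hisoπ' : IsIso (π' ∣_ (V'.ι ⁻¹ᵁ W')) := by
    rw [morphismRestrict_comp]
    have h1 : IsIso (π ∣_ eV.inv ⁻¹ᵁ (V'.ι ⁻¹ᵁ W')) :=
      isIso_morphismRestrict_of_le π hπW (le_of_eq hoverlap)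
    have h2 : IsIso (eV.inv ∣_ (V'.ι ⁻¹ᵁ W')) := inferInstance
    exact IsIso.comp_isIso' h1 h2
  obtain ⟨N, ρ, i, hi, hpb, hρW, hprop⟩ := hOG (O : Scheme.{0}) V' W' hcover Z π' hisoπ'
  haveI := hi
  haveI := hρW
  haveI : IsProper ρ := hprop inferInstance
  /- Step E: the conclusions -/
  have hsq : ∀ z : Z, ρ.base (i.base z) = V'.ι.base (π'.base z) := by
    intro z
    have := congrArg (fun g => g.base z) hpb.w
    simpa [Scheme.Hom.comp_base] using this
  have hsq' : ∀ z : Z, (ρ.base (i.base z)).1 = (π.base z).1 := by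
    intro z
    rw [hsq]
    have := heVpt (π.base z)
    simpa [π', Scheme.Hom.comp_base] using this
  -- range i = ρ⁻¹ V'
  have hrange : ∀ n : N, ρ.base n ∈ V' → ∃ z : Z, i.base z = n := by
    intro n hn
    have h1 : n ∈ ρ.base ⁻¹' Set.range V'.ι.base := by rw [Scheme.Opens.range_ι]; exact hn
    rw [← range_fst_of_isPullback' hpb] at h1
    exact h1
  -- regularity over `W'` and over `V'`
  have hregW : ∀ n : N, ρ.base n ∈ W' → (IsRegularLocalRing (N.presheaf.stalk n) ↔
      IsRegularLocalRing (M.X.presheaf.stalk (ρ.base n).1)) := by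
    intro n hn
    have h1 := mem_regularLocus_iff_of_isIso_morphismRestrict ρ W' n hn
    simp only [Scheme.mem_regularLocus] at h1
    rw [h1, mem_regularLocus_opens_iff]
  have hregV : ∀ n : N, ρ.base n ∈ V' → IsRegularLocalRing (N.presheaf.stalk n) := by
    intro n hn
    obtain ⟨z, rfl⟩ := hrange n hn
    have h1 := mem_regularLocus_iff_of_flat_of_isPreimmersion i z
    simp only [Scheme.mem_regularLocus] at h1
    exact h1.mp (hres.isRegular z)
  -- a point of `Z` over `W`; it lands in `W'`
  let z0 : Z := (π ⁻¹ᵁ W).ι.base (Classical.arbitrary _)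
  have hz0 : π.base z0 ∈ W := ((Classical.arbitrary (π ⁻¹ᵁ W : Scheme.{0}))).2
  have hz0W' : ρ.base (i.base z0) ∈ W' := by
    show (O.ι.base (ρ.base (i.base z0))) ∈ (C' : Set M.X)
    rw [show O.ι.base (ρ.base (i.base z0)) = (ρ.base (i.base z0)).1 from rfl, hsq']
    exact (hC1 (π.base z0)).not.mpr (not_not.mpr hz0)
  /- IsIntegral N -/
  haveI : IsReduced N := by
    haveI : ∀ n : N, _root_.IsReduced (N.presheaf.stalk n) := by
      intro n
      rcases (show ρ.base n ∈ V' ⊔ W' by rw [hcover]; trivial) with hn | hn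
      · obtain ⟨z, rfl⟩ := hrange n hn
        haveI := AlgebraicGeometry.isReduced_stalk_of_isReduced Z z
        exact isReduced_of_injective (asIso (i.stalkMap z)).commRingCatIsoToRingEquiv.toRingHom
          (asIso (i.stalkMap z)).commRingCatIsoToRingEquiv.injective
      · haveI := isIso_stalkMap_of_isIso_morphismRestrict ρ W' n hn
        haveI : IsReduced (O : Scheme.{0}) := isReduced_of_isOpenImmersion O.ι
        exact isReduced_of_injective (asIso (ρ.stalkMap n)).commRingCatIsoToRingEquiv.symm.toRingHom
          (asIso (ρ.stalkMap n)).commRingCatIsoToRingEquiv.symm.injective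
    exact isReduced_of_isReduced_stalk N
  haveI : Nonempty N := ⟨i.base z0⟩
  haveI : Nonempty (O : Scheme.{0}) := ⟨ρ.base (Classical.arbitrary N)⟩
  haveI : IsIntegral (O : Scheme.{0}) := isIntegral_of_isOpenImmersion O.ι
  haveI : Nonempty (ρ ⁻¹ᵁ W' : Scheme.{0}) := ⟨⟨i.base z0, hz0W'⟩⟩
  haveI : PreirreducibleSpace (W' : Scheme.{0}) := preirreducibleSpace_opens W'
  haveI : PreirreducibleSpace (ρ ⁻¹ᵁ W' : Scheme.{0}) := preirreducibleSpace_of_iso (asIso (ρ ∣_ W'))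
  haveI : PreirreducibleSpace N := by
    refine preirreducibleSpace_of_union i.isOpenEmbedding.isOpen_range (ρ ⁻¹ᵁ W').isOpen
      (isPreirreducible_range i) ?_ ?_ ⟨i.base z0, ⟨z0, rfl⟩, hz0W'⟩
    · have h := isPreirreducible_range (ρ ⁻¹ᵁ W').ι
      rwa [Scheme.Opens.range_ι] at h
    · apply Set.eq_univ_of_forall
      intro n
      rcases (show ρ.base n ∈ V' ⊔ W' by rw [hcover]; trivial) with hn | hn
      · obtain ⟨z, rfl⟩ := hrange n hn; exact Or.inl ⟨z, rfl⟩
      · exact Or.inr hn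
  haveI : IrreducibleSpace N := ⟨inferInstance⟩
  haveI hNint : IsIntegral N := isIntegral_of_irreducibleSpace_of_isReduced N
  refine ⟨O, N, ρ, hNint, inferInstance, ?_, ?_, ?_, ?_, ?_⟩
  · /- IsBirational ρ -/
    refine ⟨W', W'.isOpen.dense ⟨_, hz0W'⟩, (ρ ⁻¹ᵁ W').isOpen.dense ⟨i.base z0, hz0W'⟩, hρW⟩
  · /- clause 4 -/
    intro m hm
    exact Or.inr (hC2 m hm)
  · /- clause 5 -/
    intro m hm
    exact Or.inl hm
  · /- clause 6 -/
    intro n hn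
    have hnW : ρ.base n ∈ W' := hC2 _ hn
    exact (hregW n hnW).mpr hn
  · /- clause 7 -/
    intro n hn
    exact hregV n hn


/-! ### S1 and the join glue -/

/-- S1 `stub_resolutionInChar_of_properPatching`, verbatim signature — the landed proper-model
Zariski programme (`ZariskiPatchingProperModels.lean`). -/
theorem stub_resolutionInChar_of_properPatching :
    ∀ p : ℕ, p.Prime → ProperModel.TwoModelPatching.{0} p → (∀ (k K : Type) [Field k] [CharP k p] [Field K] [Algebra k K], (⊤ : IntermediateField k K).FG → ∀ O : ValuationSubring K, (∀ c : k, algebraMap k K c ∈ O) → ∀ R : Subalgebra k K, R.FG → R.toSubring ≤ O.toSubring → ∃ (A : Subalgebra k K) (h : A.toSubring ≤ O.toSubring), R ≤ A ∧ A.FG ∧ IsFractionRing A K ∧ IsRegularLocalRing (Localization.AtPrime (Ideal.comap (Subring.inclusion h) (IsLocalRing.maximalIdeal O)))) → ResolutionInChar.{0} p :=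
  fun _ _ hZ hLU => resolutionInChar_of_properTwoModelPatching_of_relLU hZ hLU

/-- Inline glue: RegLe-ification twice on the join gives two-model patching of proper models. -/
theorem twoModelPatching_of_regLeification (p : ℕ) (h : ProperModel.RegLeification.{0} p) :
    ProperModel.TwoModelPatching.{0} p := by
  intro k _ _ K _ _ _ M₁ M₂
  obtain ⟨M', ψ, hψ, hψ₂⟩ := h k K (ProperModel.join M₁ M₂) M₂ (ProperModel.joinSnd M₁ M₂)
  obtain ⟨M'', ψ', hψ', hψ'₁⟩ := h k K M' M₁ (ψ.comp (ProperModel.joinFst M₁ M₂))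
  exact ⟨M'', ψ'.comp (ψ.comp (ProperModel.joinFst M₁ M₂)),
    ψ'.comp (ψ.comp (ProperModel.joinSnd M₁ M₂)), hψ'₁, hψ'.comp hψ₂⟩

/-! ### The certificate -/

/-- **The line `sandwiched-gluing` closes the crux modulo its two named facts and its atom**:
Nagata compactification + two-piece relative gluing + strong resolution of sandwiched schemes in
every prime characteristic ⇒ `Valuative.PatchingRel`. -/
theorem patchingRel_of_nagata_openGluing_sand (hN : NagataCompactification.{0})
    (hOG : OpenGluing.{0}) (hS : ∀ p : ℕ, p.Prime → SandwichedStrongResolution.{0} p) :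
    Summit.ResolutionOfSingularities.ResolutionOfSingularities.Theses.Valuative.PatchingRel := by
  intro p hp hLU
  refine stub_resolutionInChar_of_properPatching p hp ?_ hLU
  apply twoModelPatching_of_regLeification
  refine stub_regLeification_of_local p (stub_properExtension_of_nagata hN) ?_
  exact stub_localRegLeification_of_sandwiched p hOG (hS p hp)

/-- The prime-by-prime slice: for each `p`, SAND⁺(p) (with the two named facts) gives the crux's
implication `LUrel_p → ResolutionInChar p`. -/
theorem resolutionInChar_of_nagata_openGluing_sand (p : ℕ) (hp : p.Prime)
    (hN : NagataCompactification.{0}) (hOG : OpenGluing.{0}) (hS : SandwichedStrongResolution.{0} p)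
    (hLU : ∀ (k K : Type) [Field k] [CharP k p] [Field K] [Algebra k K], (⊤ : IntermediateField k K).FG → ∀ O : ValuationSubring K, (∀ c : k, algebraMap k K c ∈ O) → ∀ R : Subalgebra k K, R.FG → R.toSubring ≤ O.toSubring → ∃ (A : Subalgebra k K) (h : A.toSubring ≤ O.toSubring), R ≤ A ∧ A.FG ∧ IsFractionRing A K ∧ IsRegularLocalRing (Localization.AtPrime (Ideal.comap (Subring.inclusion h) (IsLocalRing.maximalIdeal O)))) :
    ResolutionInChar.{0} p :=
  stub_resolutionInChar_of_properPatching p hp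
    (twoModelPatching_of_regLeification p
      (stub_regLeification_of_local p (stub_properExtension_of_nagata hN)
        (stub_localRegLeification_of_sandwiched p hOG hS))) hLU

end Literature.AlgebraicGeometry.Resolution.SandwichedGluing
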